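import Summits.AtomisticToContinuum.BoseEinsteinCondensation.Theorems.BECCutLineWeakDisorderTwoReplicaTransienceBoundInsertionStepBounded
import Summits.AtomisticToContinuum.BoseEinsteinCondensation.Theorems.BECCutLineWeakDisorderTwoReplicaTransienceBoundSliceBound
import Literature.MathematicalPhysics.QuantumManyBody.BoseGasThermodynamicLimitRuelle
import Mathlib.MeasureTheory.Group.LIntegral
import HarnessLib

/-!
# Crux `TwoReplicaTransienceBound` (stmt-AtomisticToContinuum-9687), line `SketchIdeator1` v6:
# EVERY SLICE IS FLAT on the chemical-potential window, for bounded pair potentials (stub `stub_sliceFlatBounded`)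

Support file (`--supports stmt-AtomisticToContinuum-9687`, lead c3). A POINTWISE-in-the-slice strengthening of the
chemical-potential window `…ShortTimeBounded.lean`, with no recursion and for EVERY particle number: for bounded admissible `v`,

* `lintegral_lintegral_taggedBathAction_le` — PATHWISE in the bath: the tagged–bath action, averaged over the tagged sample and
  integrated over the tagged starting point, is at most `n · t · ‖v‖₁` for EVERY bath configuration and EVERY bath path
  (`∫_{ℝ³} v(|x + b_s − ω_s|) dx = ‖v‖₁`, translation invariance of Lebesgue measure; Tonelli);
* `lintegral_tracer_ge` — hence `∫ₓ tracer(x,Y,ωb) dx ≥ ∫θ_t − n t ‖v‖₁` pathwise (tangent bound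
  `InsertionBounded.fkPartition_one_le_tracer_add` integrated over `x`);
* `slice_ratio_le` — for EVERY slice `Y`: `L³ m(Y)²/s(Y)² ≤ (2L³/θ₀) · m(Y)` as soon as `n T ‖v‖₁ ≤ θ₀/2`, where
  `θ₀ = q₀ (L/2)³ ≤ ∫θ_T` (`T ≤ L²/960`) — i.e. the insertion profile `x ↦ Z(x::Y)/Z_n(Y)` of EVERY slice has participation
  ratio `≤ 16/q₀` on the window (slice bound `m ≤ Z_n s` from `…SliceBound.lean`, and `s ≥ Z_n (∫θ − nT‖v‖₁)`);
* `stub_sliceFlatBounded` — integrating (`∫ m = ‖Z‖₂²`): for every bounded admissible `v` there is `κ(v) = q₀/(16(‖v‖₁+1))` with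
  `∫ L³ m_T²/s_T² dY ≤ 20` for EVERY `ρ > 0`, EVERY `n` and every `0 ≤ T ≤ κ/ρ` with `T ≤ L²/960`, `L = sideLength ρ (n+1)`.

So on the chemical-potential window not only the second moment `E_Q[R]` but `sup_Y R(Y)` is bounded: no slice of the finite-`T`
witness is localised before the insertion cost `e^{-μT}`, `μ ≈ ρ‖v‖₁`, becomes appreciable.
-/

noncomputable section

open MeasureTheory Filter Set
open scoped ENNReal NNReal Topology BigOperators

namespace Summit.AtomisticToContinuum.BoseEinsteinCondensation.Cruxes.TwoReplicaTransienceBound.SliceFlat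

open Literature.MathematicalPhysics.QuantumManyBody.BoseGas
open Literature.Probability.Process (brownian)
open Summit.AtomisticToContinuum.BoseEinsteinCondensation.Theorems.CutLineWitness
open Summit.AtomisticToContinuum.BoseEinsteinCondensation.Cruxes.TwoReplicaTransienceBound.TracerDecoupling
open TracerFactorisation TracerMeasurability

variable {n : ℕ}

/-! ### The tagged–bath action integrated over the tagged starting point, pathwise in the bath -/

/-- Translation invariance: `∫ v(|x + d − p|) dx = ‖v‖₁` for all displacements. -/
theorem lintegral_v_dist_add (v : ℝ → ℝ≥0∞) (d p : Space) :
    ∫⁻ x : Space, v (dist (x + d) p) = ∫⁻ y : Space, v ‖y‖ := by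
  have h : ∀ x : Space, dist (x + d) p = ‖x + (d - p)‖ := fun x => by
    rw [dist_eq_norm]; congr 1; abel
  simp_rw [h]
  exact lintegral_add_right_eq_self (μ := (volume : Measure Space)) (fun y => v ‖y‖) (d - p)

/-- **Pathwise bound on the integrated tagged–bath action**: for EVERY bath configuration `Y` and EVERY bath sample `ωb`,
`∫ dx E_{ω₀}[∫₀ᵗ Σⱼ v(|B⁰_s − Bʲ_s|) ds] ≤ n · t · ‖v‖₁` (in fact equality up to the order of integration): Tonelli, and the
`x`-integral of each summand is `‖v‖₁` by translation invariance. -/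
theorem lintegral_lintegral_taggedBathAction_le {v : ℝ → ℝ≥0∞} (hv : Measurable v) (t : ℝ)
    (Y : Config n) (ωb : PathSpace n) :
    ∫⁻ x, ∫⁻ ω₀, taggedBathAction v t x Y ω₀ ωb ∂wienerLine ≤
      (n : ℝ≥0∞) * ENNReal.ofReal t * ∫⁻ y : Space, v ‖y‖ := by
  -- the integrand as a function of `((x, ω₀), s)`
  obtain ⟨F, hF⟩ : ∃ F : (Space × (Fin 3 → (ℝ≥0 → ℝ))) × ℝ → ℝ≥0∞, ∀ q, F q = ∑ j : Fin n,
      v (dist (worldLine (Matrix.vecCons q.1.1 Y) (Fin.cons q.1.2 ωb) q.2.toNNReal 0)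
        (worldLine (Matrix.vecCons q.1.1 Y) (Fin.cons q.1.2 ωb) q.2.toNNReal j.succ)) := ⟨_, fun _ => rfl⟩
  have hFm : Measurable F := by
    rw [show F = _ from funext hF]
    have hX : Measurable fun q : (Space × (Fin 3 → (ℝ≥0 → ℝ))) × ℝ => (Matrix.vecCons q.1.1 Y : Config (n + 1)) := by
      have h := measurable_vecCons_prod.comp ((measurable_fst.comp measurable_fst).prodMk
        (measurable_const (a := Y) : Measurable fun _ : (Space × (Fin 3 → (ℝ≥0 → ℝ))) × ℝ => Y))
      exact h
    have hω : Measurable fun q : (Space × (Fin 3 → (ℝ≥0 → ℝ))) × ℝ => (Fin.cons q.1.2 ωb : PathSpace (n + 1)) :=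
      measurable_finCons (measurable_snd.comp measurable_fst) measurable_const
    exact measurable_taggedBathIntegrand hv hX hω measurable_snd
  -- Tonelli: `(x, ω₀)` inside, `s` outside
  have hswap : ∫⁻ x, ∫⁻ ω₀, taggedBathAction v t x Y ω₀ ωb ∂wienerLine =
      ∫⁻ s in Set.Ioc 0 t, ∫⁻ x, ∫⁻ ω₀, F ((x, ω₀), s) ∂wienerLine := by
    have h1 : ∀ x : Space, ∫⁻ ω₀, taggedBathAction v t x Y ω₀ ωb ∂wienerLine =
        ∫⁻ s in Set.Ioc 0 t, ∫⁻ ω₀, F ((x, ω₀), s) ∂wienerLine := by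
      intro x
      have hm : Measurable fun q : (Fin 3 → (ℝ≥0 → ℝ)) × ℝ => F ((x, q.1), q.2) := by
        have h := hFm.comp ((measurable_prodMk_left (x := x)).comp measurable_fst |>.prodMk measurable_snd)
        exact h
      calc ∫⁻ ω₀, taggedBathAction v t x Y ω₀ ωb ∂wienerLine
          = ∫⁻ ω₀, (∫⁻ s in Set.Ioc 0 t, F ((x, ω₀), s)) ∂wienerLine := by
            simp only [taggedBathAction, hF]
        _ = _ := lintegral_lintegral_swap (hm.aemeasurable)
    simp_rw [h1]
    have hm2 : Measurable fun q : Space × ℝ => ∫⁻ ω₀, F ((q.1, ω₀), q.2) ∂wienerLine := by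
      have h3 : Measurable fun q : (Space × ℝ) × (Fin 3 → (ℝ≥0 → ℝ)) => F ((q.1.1, q.2), q.1.2) := by
        have h := hFm.comp (((measurable_fst.comp measurable_fst).prodMk measurable_snd).prodMk
          (measurable_snd.comp measurable_fst))
        exact h
      exact h3.lintegral_prod_right'
    exact lintegral_lintegral_swap hm2.aemeasurable
  rw [hswap]
  -- for each time `s`: swap `x` and `ω₀`, integrate `x` first (translation invariance)
  have hstep : ∀ s : ℝ, ∫⁻ x, ∫⁻ ω₀, F ((x, ω₀), s) ∂wienerLine ≤ (n : ℝ≥0∞) * ∫⁻ y : Space, v ‖y‖ := by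
    intro s
    have hm : Measurable fun q : Space × (Fin 3 → (ℝ≥0 → ℝ)) => F (q, s) := by
      have h := hFm.comp (measurable_id.prodMk (measurable_const (a := s)))
      exact h
    rw [lintegral_lintegral_swap hm.aemeasurable]
    have hin : ∀ ω₀ : Fin 3 → (ℝ≥0 → ℝ), ∫⁻ x, F ((x, ω₀), s) = (n : ℝ≥0∞) * ∫⁻ y : Space, v ‖y‖ := by
      intro ω₀
      have hj : ∀ j : Fin n, Measurable fun x : Space =>
          v (dist (worldLine (Matrix.vecCons x Y) (Fin.cons ω₀ ωb) s.toNNReal 0)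
            (worldLine (Matrix.vecCons x Y) (Fin.cons ω₀ ωb) s.toNNReal j.succ)) := by
        intro j
        simp only [worldLine_vecCons_cons_zero, worldLine_vecCons_cons_succ]
        exact hv.comp ((continuous_id.add continuous_const).measurable.dist measurable_const)
      simp_rw [hF]
      rw [lintegral_finsetSum _ fun j _ => hj j]
      simp only [worldLine_vecCons_cons_zero, worldLine_vecCons_cons_succ, lintegral_v_dist_add]
      rw [Finset.sum_const, Finset.card_univ, Fintype.card_fin, nsmul_eq_mul]
    simp_rw [hin]
    rw [lintegral_const, measure_univ, mul_one]
  calc ∫⁻ s in Set.Ioc 0 t, ∫⁻ x, ∫⁻ ω₀, F ((x, ω₀), s) ∂wienerLine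
      ≤ ∫⁻ _s in Set.Ioc 0 t, (n : ℝ≥0∞) * ∫⁻ y : Space, v ‖y‖ := lintegral_mono fun s => hstep s
    _ = (n : ℝ≥0∞) * ENNReal.ofReal t * ∫⁻ y : Space, v ‖y‖ := by
        rw [setLIntegral_const, Real.volume_Ioc, sub_zero]; ring

/-- **Pathwise lower bound on the tracer mass**: `∫θ_t − n t ‖v‖₁ ≤ ∫ₓ tracer(x, Y, ωb) dx` for every slice and every bath
sample (the tangent bound integrated over the tagged starting point). -/
theorem lintegral_tracer_ge {v : ℝ → ℝ≥0∞} (hv : Measurable v) (L t : ℝ) (Y : Config n) (ωb : PathSpace n) :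
    (∫⁻ x, fkPartition (N := 1) (fun _ => 0) L t (fun _ => x)) - (n : ℝ≥0∞) * ENNReal.ofReal t * ∫⁻ y : Space, v ‖y‖ ≤
      ∫⁻ x, tracer v L t x Y ωb := by
  refine tsub_le_iff_right.2 ?_
  have htr : Measurable fun x => tracer v L t x Y ωb := by
    have h := (stub_tracerMeasurable n v hv L t Y).comp (measurable_id.prodMk (measurable_const (a := ωb)))
    exact h
  calc ∫⁻ x, fkPartition (N := 1) (fun _ => 0) L t (fun _ => x)
      ≤ ∫⁻ x, (tracer v L t x Y ωb + ∫⁻ ω₀, taggedBathAction v t x Y ω₀ ωb ∂wienerLine) :=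
        lintegral_mono fun x => InsertionBounded.fkPartition_one_le_tracer_add hv L t x Y ωb
    _ = (∫⁻ x, tracer v L t x Y ωb) + ∫⁻ x, ∫⁻ ω₀, taggedBathAction v t x Y ω₀ ωb ∂wienerLine := lintegral_add_left htr _
    _ ≤ _ := add_le_add le_rfl (lintegral_lintegral_taggedBathAction_le hv t Y ωb)

/-! ### Every slice is flat on the window -/

/-- **The slice mass from below**: `s(Y) = ∫ₓ Z(x::Y) ≥ Z_n(Y) · (∫θ_t − n t ‖v‖₁)` (factorisation through the tracer, Tonelli,
`lintegral_tracer_ge`). -/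
theorem slice_mass_ge {v : ℝ → ℝ≥0∞} (hv : Measurable v) (L t : ℝ) (Y : Config n) :
    fkPartition v L t Y *
        ((∫⁻ x, fkPartition (N := 1) (fun _ => 0) L t (fun _ => x)) - (n : ℝ≥0∞) * ENNReal.ofReal t * ∫⁻ y : Space, v ‖y‖) ≤
      ∫⁻ x, fkPartition v L t (Matrix.vecCons x Y) := by
  have hsw : ∫⁻ x, fkPartition v L t (Matrix.vecCons x Y) =
      ∫⁻ ωb, fkWeight v L t Y ωb * (∫⁻ x, tracer v L t x Y ωb) ∂wienerPaths n := by
    have hf : ∀ x : Space, fkPartition v L t (Matrix.vecCons x Y) =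
        ∫⁻ ωb, fkWeight v L t Y ωb * tracer v L t x Y ωb ∂wienerPaths n := fun x => stub_factorisation n v hv L t x Y
    simp_rw [hf]
    have hm : Measurable fun q : Space × PathSpace n => fkWeight v L t Y q.2 * tracer v L t q.1 Y q.2 :=
      ((measurable_fkWeight hv L t Y).comp measurable_snd).mul (stub_tracerMeasurable n v hv L t Y)
    rw [lintegral_lintegral_swap hm.aemeasurable]
    refine lintegral_congr fun ωb => ?_
    have htr : Measurable fun x => tracer v L t x Y ωb := by
      have h := (stub_tracerMeasurable n v hv L t Y).comp (measurable_id.prodMk (measurable_const (a := ωb)))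
      exact h
    rw [lintegral_const_mul _ htr]
  rw [hsw, InsertionBounded.fkPartition_eq_lintegral_fkWeight v L t Y, ← lintegral_mul_const _ (measurable_fkWeight hv L t Y)]
  exact lintegral_mono fun ωb => mul_le_mul' le_rfl (lintegral_tracer_ge hv L t Y ωb)

/-- **Every slice is flat on the window**: if `θ₀ ≤ ∫θ_t` and the error `n t ‖v‖₁ ≤ θ₀/2` (with `θ₀` finite and nonzero), then for
EVERY slice `Y` the un-normalised crux integrand satisfies `L³ m(Y)²/s(Y)² ≤ (2L³/θ₀) · m(Y)`: participation ratio of the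
insertion profile `≤ 2L³/θ₀`. (`m ≤ Z_n s` from the slice bound, `s ≥ Z_n θ₀/2` from `slice_mass_ge`.) -/
theorem slice_ratio_le {v : ℝ → ℝ≥0∞} (hv : Measurable v) (L t : ℝ) {θ₀ : ℝ≥0∞} (hθ₀ : θ₀ ≠ 0)
    (hθ₀t : θ₀ ≠ ⊤) (hfloor : θ₀ ≤ ∫⁻ x, fkPartition (N := 1) (fun _ => 0) L t (fun _ => x))
    (herr : 2 * ((n : ℝ≥0∞) * ENNReal.ofReal t * ∫⁻ y : Space, v ‖y‖) ≤ θ₀) (Y : Config n) :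
    ENNReal.ofReal (L ^ 3) * (∫⁻ x, fkPartition v L t (Matrix.vecCons x Y) ^ 2) ^ 2 /
        (∫⁻ x, fkPartition v L t (Matrix.vecCons x Y)) ^ 2 ≤
      (2 * ENNReal.ofReal (L ^ 3) / θ₀) * ∫⁻ x, fkPartition v L t (Matrix.vecCons x Y) ^ 2 := by
  set m := ∫⁻ x, fkPartition v L t (Matrix.vecCons x Y) ^ 2 with hm
  set s := ∫⁻ x, fkPartition v L t (Matrix.vecCons x Y) with hs
  set Zn := fkPartition v L t Y with hZn
  set E := (n : ℝ≥0∞) * ENNReal.ofReal t * ∫⁻ y : Space, v ‖y‖ with hE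
  -- `m ≤ Zn · s` (slice bound) and `Zn · (θ₀ − E) ≤ s`, with `θ₀/2 ≤ θ₀ − E`
  have hms : m ≤ s * Zn := by
    have hmeas : Measurable fun x : Space => fkPartition v L t (Matrix.vecCons x Y) :=
      (measurable_fkSemigroup hv L t measurable_const).comp (measurable_vecCons_left Y)
    rw [hm, hs, ← lintegral_mul_const _ hmeas]
    refine lintegral_mono fun x => ?_
    rw [sq]
    exact mul_le_mul' le_rfl (ShortTime.fkPartition_vecCons_le hv L t x Y)
  have hE2 : E ≤ θ₀ / 2 := by
    rw [ENNReal.le_div_iff_mul_le (Or.inl two_ne_zero) (Or.inl ENNReal.ofNat_ne_top), mul_comm]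
    exact herr
  have hhalf : θ₀ / 2 ≤ θ₀ - E := by
    calc θ₀ / 2 = θ₀ - θ₀ / 2 := (ENNReal.sub_half hθ₀t).symm
      _ ≤ θ₀ - E := tsub_le_tsub_left hE2 _
  have hsZ : Zn * (θ₀ / 2) ≤ s :=
    (mul_le_mul' le_rfl (hhalf.trans (tsub_le_tsub_right hfloor _))).trans (slice_mass_ge hv L t Y)
  have hh0 : θ₀ / 2 ≠ 0 := (ENNReal.div_pos hθ₀ ENNReal.ofNat_ne_top).ne'
  have hht : θ₀ / 2 ≠ ⊤ := ENNReal.div_ne_top hθ₀t two_ne_zero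
  -- `m²/s² ≤ m·Zn/s ≤ m·Zn/(Zn θ₀/2) = m/(θ₀/2)`
  rcases eq_or_ne s 0 with hs0 | hs0
  · have hm0 : m = 0 := by simpa [hs0] using hms
    simp [hm0]
  have hmeas : Measurable fun x : Space => fkPartition v L t (Matrix.vecCons x Y) :=
    (measurable_fkSemigroup hv L t measurable_const).comp (measurable_vecCons_left Y)
  have hZn0 : Zn ≠ 0 := by
    intro h0
    -- `Zn = 0` forces `m = 0` and hence `s = 0`, contradicting `hs0`
    have hm0 : m = 0 := by simpa [h0] using hms
    have hae := (lintegral_eq_zero_iff (hmeas.pow_const 2)).1 hm0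
    apply hs0
    rw [hs]
    refine (lintegral_eq_zero_iff hmeas).2 (hae.mono fun x hx => ?_)
    simpa using hx
  have hZnt : Zn ≠ ⊤ := fkPartition_ne_top v L t Y
  calc ENNReal.ofReal (L ^ 3) * m ^ 2 / s ^ 2
      = ENNReal.ofReal (L ^ 3) * (m ^ 2 / s ^ 2) := by rw [mul_div_assoc]
    _ ≤ ENNReal.ofReal (L ^ 3) * (m * Zn / s) := mul_le_mul' le_rfl (sq_div_sq_le_mul_div hms)
    _ ≤ ENNReal.ofReal (L ^ 3) * (m * Zn / (Zn * (θ₀ / 2))) :=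
        mul_le_mul' le_rfl (ENNReal.div_le_div_left hsZ _)
    _ = ENNReal.ofReal (L ^ 3) * (m / (θ₀ / 2)) := by
        congr 1
        rw [mul_comm Zn (θ₀ / 2), ENNReal.mul_div_mul_right _ _ hZn0 hZnt]
    _ = (2 * ENNReal.ofReal (L ^ 3) / θ₀) * m := by
        rw [div_eq_mul_inv m, ENNReal.inv_div (Or.inl ENNReal.ofNat_ne_top) (Or.inl two_ne_zero),
          div_eq_mul_inv, div_eq_mul_inv]
        ring

/-- The free survival mass from below at time `t ≤ L²/960`: `q₀ (L/2)³ ≤ ∫ θ_t` (middle cube, as in `…SurvivalFloor.lean` but at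
time `t` itself). -/
theorem lintegral_fkPartition_one_ge {L t : ℝ} (hL : 0 < L) (ht : 0 ≤ t) (htL : t ≤ L ^ 2 / 960) :
    ENNReal.ofReal ((1 - 6 * Real.exp (-5)) * (L / 2) ^ 3) ≤ ∫⁻ x, fkPartition (N := 1) (fun _ => 0) L t (fun _ => x) := by
  calc ENNReal.ofReal ((1 - 6 * Real.exp (-5)) * (L / 2) ^ 3)
      = ENNReal.ofReal (1 - 6 * Real.exp (-5)) * volume {x : Space | ∀ k, x k ∈ Set.Ioo (L / 4) (3 * L / 4)} := by
        rw [ENNReal.ofReal_mul FreeGas.q0_pos.le, ENNReal.ofReal_pow (by positivity), FreeGas.volume_middle]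
    _ = ∫⁻ _ in {x : Space | ∀ k, x k ∈ Set.Ioo (L / 4) (3 * L / 4)}, ENNReal.ofReal (1 - 6 * Real.exp (-5)) :=
        (setLIntegral_const _ _).symm
    _ ≤ ∫⁻ x in {x : Space | ∀ k, x k ∈ Set.Ioo (L / 4) (3 * L / 4)}, fkPartition (N := 1) (fun _ => 0) L t (fun _ => x) :=
        setLIntegral_mono (FreeGas.measurable_fkPartition_one measurable_const L t)
          fun _ hx => FreeGas.fkPartition_one_ge_on_middle measurable_const hL hx ht htL
    _ ≤ _ := setLIntegral_le_lintegral _ _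

end Summit.AtomisticToContinuum.BoseEinsteinCondensation.Cruxes.TwoReplicaTransienceBound.SliceFlat

namespace Summit.AtomisticToContinuum.BoseEinsteinCondensation.Cruxes.TwoReplicaTransienceBound.TracerDecoupling

open Literature.MathematicalPhysics.QuantumManyBody.BoseGas
open Summit.AtomisticToContinuum.BoseEinsteinCondensation.Theorems.CutLineWitness
open Summit.AtomisticToContinuum.BoseEinsteinCondensation.Cruxes.TwoReplicaTransienceBound.SliceFlat

/-- **Registered toolbox stub `stub_sliceFlatBounded`** (crux stmt-AtomisticToContinuum-9687, line `SketchIdeator1` v6): the crux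
integral is `≤ 20` for EVERY bounded admissible `v`, EVERY density `ρ > 0`, EVERY particle number `n` and every polymer length
`0 ≤ T ≤ κ(v)/ρ` in a box large compared to `√T` (`T ≤ L²/960`), `κ(v) = q₀/(16(‖v‖₁+1))` — because EVERY slice is flat there
(`SliceFlat.slice_ratio_le`), not only the second moment. -/
theorem stub_sliceFlatBounded :
    ∀ (v : ℝ → ENNReal), IsRepulsiveFiniteRange v → (∃ C : NNReal, ∀ r, v r ≤ C) →
      ∃ κ : ℝ, 0 < κ ∧ ∀ ρ : ℝ, 0 < ρ → ∀ (n : ℕ) (T : ℝ), 0 ≤ T → T ≤ κ / ρ → T ≤ sideLength ρ (n + 1) ^ 2 / 960 →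
        ∫⁻ Y : Config n, ENNReal.ofReal (sideLength ρ (n + 1) ^ 3) *
            (∫⁻ x, (‖@fkWitness (n + 1) v (sideLength ρ (n + 1)) T (fun _ => (1 : ENNReal))
              (Matrix.vecCons x Y)‖₊ : ENNReal) ^ 2) ^ 2 /
            (∫⁻ x, (‖@fkWitness (n + 1) v (sideLength ρ (n + 1)) T (fun _ => (1 : ENNReal))
              (Matrix.vecCons x Y)‖₊ : ENNReal)) ^ 2 ≤ ENNReal.ofReal 20 := by
  intro v hv hb
  obtain ⟨hvm, R₀, hR₀⟩ := hv
  obtain ⟨C, hC⟩ := hb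
  -- `‖v‖₁ < ∞`
  set R : ℝ := max R₀ 0 with hRdef
  have hvR : ∀ r, R < r → v r = 0 := fun r hr => hR₀ r (lt_of_le_of_lt (le_max_left _ _) hr)
  set V₁ : ℝ≥0∞ := ∫⁻ y : Space, v ‖y‖ with hV₁def
  have hV₁le : V₁ ≤ (C : ℝ≥0∞) * volume (Metric.closedBall (0 : Space) R) := by
    calc V₁ ≤ ∫⁻ y : Space, (Metric.closedBall (0 : Space) R).indicator (fun _ => (C : ℝ≥0∞)) y := by
          refine lintegral_mono fun y => ?_
          by_cases hy : y ∈ Metric.closedBall (0 : Space) R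
          · rw [Set.indicator_of_mem hy]; exact hC _
          · rw [Set.indicator_of_notMem hy]
            have hfar : R < ‖y‖ := by
              rw [Metric.mem_closedBall, dist_zero_right, not_le] at hy; exact hy
            rw [hvR _ hfar]
      _ = (C : ℝ≥0∞) * volume (Metric.closedBall (0 : Space) R) :=
          lintegral_indicator_const Metric.isClosed_closedBall.measurableSet _
  have hV₁top : V₁ ≠ ⊤ :=
    ne_top_of_le_ne_top (ENNReal.mul_ne_top ENNReal.coe_ne_top measure_closedBall_lt_top.ne) hV₁le
  set V : ℝ := V₁.toReal with hVdef
  have hV : 0 ≤ V := ENNReal.toReal_nonneg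
  have hVeq : V₁ = ENNReal.ofReal V := (ENNReal.ofReal_toReal hV₁top).symm
  set q₀ : ℝ := 1 - 6 * Real.exp (-5) with hq₀def
  have hq₀ : 0 < q₀ := FreeGas.q0_pos
  refine ⟨q₀ / (16 * (V + 1)), by positivity, fun ρ hρ n T hT hTκ hTL => ?_⟩
  set L : ℝ := sideLength ρ (n + 1) with hLdef
  have hL : 0 < L := Real.rpow_pos_of_pos (div_pos (by exact_mod_cast Nat.succ_pos n) hρ) _
  have hL3 : L ^ 3 = ((n + 1 : ℕ) : ℝ) / ρ := sideLength_pow_three hρ (n + 1)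
  -- the floor and the error condition
  set θ₀ : ℝ≥0∞ := ENNReal.ofReal (q₀ * (L / 2) ^ 3) with hθ₀def
  have hθ₀pos : θ₀ ≠ 0 := (ENNReal.ofReal_pos.2 (by positivity)).ne'
  have hθ₀top : θ₀ ≠ ⊤ := ENNReal.ofReal_ne_top
  have hfloor : θ₀ ≤ ∫⁻ x, fkPartition (N := 1) (fun _ => 0) L T (fun _ => x) := lintegral_fkPartition_one_ge hL hT hTL
  have herr : 2 * ((n : ℝ≥0∞) * ENNReal.ofReal T * V₁) ≤ θ₀ := by
    have hreal : 2 * ((n : ℝ) * T * V) ≤ q₀ * (L / 2) ^ 3 := by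
      have hn0 : (0 : ℝ) ≤ n := Nat.cast_nonneg n
      have h1 : T * ρ * (16 * (V + 1)) ≤ q₀ := by
        have := hTκ
        rw [le_div_iff₀ hρ, le_div_iff₀ (by positivity)] at this
        exact this
      have h3 : q₀ * (L / 2) ^ 3 = q₀ * L ^ 3 / 8 := by ring
      rw [h3, hL3, Nat.cast_succ, le_div_iff₀ (by norm_num : (0 : ℝ) < 8)]
      have hρne : ρ ≠ 0 := hρ.ne'
      field_simp
      nlinarith [mul_nonneg hn0 hV, mul_nonneg hn0 hT, mul_nonneg (mul_nonneg hn0 hV) hT, hρ.le,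
        mul_nonneg (mul_nonneg (mul_nonneg hn0 hV) hT) hρ.le]
    have hn0' : (0 : ℝ) ≤ n := Nat.cast_nonneg n
    calc 2 * ((n : ℝ≥0∞) * ENNReal.ofReal T * V₁) = ENNReal.ofReal (2 * ((n : ℝ) * T * V)) := by
          rw [hVeq, ENNReal.ofReal_mul (p := 2) (by norm_num), ENNReal.ofReal_ofNat,
            ENNReal.ofReal_mul (p := (n : ℝ) * T) (by positivity), ENNReal.ofReal_mul (p := (n : ℝ)) hn0',
            ENNReal.ofReal_natCast]
      _ ≤ θ₀ := ENNReal.ofReal_le_ofReal hreal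
  -- every slice is flat
  have hslice := fun Y : Config n => slice_ratio_le (n := n) hvm L T hθ₀pos hθ₀top hfloor herr Y
  /- ### normalisation bookkeeping -/
  set 𝒩 : ℝ≥0∞ := fkNormSq (N := n + 1) v L T (fun _ => (1 : ℝ≥0∞)) with h𝒩
  set c : ℝ := (Real.sqrt 𝒩.toReal)⁻¹ with hc
  have hΨ : ∀ X, fkWitness (N := n + 1) v L T (fun _ => (1 : ℝ≥0∞)) X = c * (fkPartition v L T X).toReal :=
    fun X => fkWitness_one_eq v L T X
  by_cases hc0 : c = 0
  · have h0 : ∀ X, fkWitness (N := n + 1) v L T (fun _ => (1 : ℝ≥0∞)) X = 0 := fun X => by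
      rw [hΨ X, hc0, zero_mul]
    simp [h0]
  have hsqrt : Real.sqrt 𝒩.toReal ≠ 0 := fun h => hc0 (by rw [hc, h, inv_zero])
  have htR : 0 < 𝒩.toReal := not_le.1 fun h => hsqrt (Real.sqrt_eq_zero'.2 h)
  have h𝒩0 : 𝒩 ≠ 0 := fun h => htR.ne' (by rw [h, ENNReal.toReal_zero])
  have h𝒩top : 𝒩 ≠ ⊤ := fun h => htR.ne' (by rw [h, ENNReal.toReal_top])
  have hc𝒩 : ENNReal.ofReal (c ^ 2) * 𝒩 = 1 := by
    have hc2 : c ^ 2 = (𝒩.toReal)⁻¹ := by rw [hc, inv_pow, Real.sq_sqrt htR.le]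
    rw [hc2, ENNReal.ofReal_inv_of_pos htR, ENNReal.ofReal_toReal h𝒩top, ENNReal.inv_mul_cancel h𝒩0 h𝒩top]
  have hnn : ∀ X : Config (n + 1), (‖(fkPartition v L T X).toReal‖₊ : ℝ≥0∞) = fkPartition v L T X :=
    fun X => coe_nnnorm_toReal (fkPartition_ne_top v L T X)
  simp_rw [hΨ]
  rw [lintegral_ratio_const_mul L (fun X => (fkPartition v L T X).toReal) hc0]
  simp_rw [hnn]
  -- `∫ (2L³/θ₀) m(Y) dY = (2L³/θ₀) 𝒩`
  have hmm : Measurable fun Y : Config n => ∫⁻ x, fkPartition v L T (Matrix.vecCons x Y) ^ 2 := by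
    have h : Measurable fun p : Space × Config n => fkPartition v L T (Matrix.vecCons p.1 p.2) ^ 2 := by
      have h' := ((measurable_fkSemigroup hvm L T (measurable_const (a := (1 : ℝ≥0∞)))).comp
        (measurable_vecCons_prod (n := n))).pow_const 2
      exact h'
    have h2 := h.lintegral_prod_left' (μ := (volume : Measure Space))
    exact h2
  have hsum : ∫⁻ Y : Config n, ∫⁻ x, fkPartition v L T (Matrix.vecCons x Y) ^ 2 = 𝒩 := by
    rw [h𝒩, fkNormSq, lintegral_eq_lintegral_lintegral_vecCons ((measurable_fkSemigroup hvm L T measurable_const).pow_const 2)]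
    rfl
  calc ENNReal.ofReal (c ^ 2) * ∫⁻ Y : Config n, ENNReal.ofReal (L ^ 3) *
          (∫⁻ x, fkPartition v L T (Matrix.vecCons x Y) ^ 2) ^ 2 / (∫⁻ x, fkPartition v L T (Matrix.vecCons x Y)) ^ 2
      ≤ ENNReal.ofReal (c ^ 2) * ∫⁻ Y : Config n, (2 * ENNReal.ofReal (L ^ 3) / θ₀) *
          ∫⁻ x, fkPartition v L T (Matrix.vecCons x Y) ^ 2 := mul_le_mul' le_rfl (lintegral_mono hslice)
    _ = 2 * ENNReal.ofReal (L ^ 3) / θ₀ * (ENNReal.ofReal (c ^ 2) * 𝒩) := by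
        rw [lintegral_const_mul _ hmm, hsum]; ring
    _ = 2 * ENNReal.ofReal (L ^ 3) / θ₀ := by rw [hc𝒩, mul_one]
    _ ≤ ENNReal.ofReal 20 := by
        have hL3pos : 0 < L ^ 3 := by positivity
        rw [hθ₀def, ← ENNReal.ofReal_ofNat 2, ← ENNReal.ofReal_mul (by norm_num),
          ← ENNReal.ofReal_div_of_pos (by positivity)]
        refine ENNReal.ofReal_le_ofReal ?_
        rw [div_le_iff₀ (by positivity)]
        have h16 := ShortTime.sixteen_le_twenty_mul_q0
        nlinarith [hL3pos, h16, hq₀]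

end Summit.AtomisticToContinuum.BoseEinsteinCondensation.Cruxes.TwoReplicaTransienceBound.TracerDecoupling

end
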